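import Summits.KontsevichZagierPeriods.KontsevichZagierPeriods.Theses.SymplecticScissors
import Literature.NumberTheory.Transcendental.KZCalculusProofs
import Literature.NumberTheory.Transcendental.KZGroundingRelations
import Literature.NumberTheory.Transcendental.SemialgebraicMapsProofs

/-!
# `PlanarAreas` (stmt-KontsevichZagierPeriods-4990), line `green-native-bands` — stub `stub_swap`

**The coordinate swap is a move.** For an ARBITRARY planar Kontsevich–Zagier representation
`r = [σ, f]` (any `ℚ`-semialgebraic integrand, domain possibly null or of infinite measure)
the swapped representation `r' = [swap⁻¹ σ, f ∘ swap]`, `swap (x, y) = (y, x)`, exists and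
`[r] − [r'] ∈ KZ.relations`: one instance of rule (2) (change of variables,
`KZ.changeOfVariablesRel`) with `Φ = Φ' =` the permutation matrix of the transposition, which
is an involution, so `det Φ' = ±1` and `|det Φ'| = 1` (no volume argument is needed, in
contrast with the model `KZ.of_sub_of_mem_relations_perm`, which treats integrand `1` on a
domain of finite volume).

Construction of `r'`: the domain `{q | (q 1, q 0) ∈ σ}` is the preimage of `σ` under a
coordinate map (`IsSemialgebraic.preimage_comp`); the integrand `q ↦ f (q 1, q 0)` is the
composite of `f` with a polynomial map (`IsSemialgebraicFunOn.comp_isSemialgebraicMapOn_holds`);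
integrability is transported along the measure-preserving measurable equivalence `q ↦ q ∘ swap`
(`MeasurePreserving.integrableOn_comp_preimage`).

References: M. Kontsevich, D. Zagier, *Periods* (2001), §1.2, rule (2); J. Bochnak, M. Coste,
M.-F. Roy, *Real Algebraic Geometry* (1998), Prop. 2.2.6.
-/

noncomputable section

open scoped BigOperators
open Set MeasureTheory
open Literature.NumberTheory.Transcendental
open Literature.ModelTheory.ExponentialFields (IsSemialgebraic)

namespace Summit.KontsevichZagierPeriods.SymplecticScissors.PlanarAreas

/-! ## The swap `q ↦ (q 1, q 0)` as precomposition with the transposition `(0 1)` -/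

/-- Precomposition with the transposition `(0 1)` of `Fin 2` is the swap `q ↦ (q 1, q 0)`.
[folklore] -/
theorem comp_swap_eq (q : Fin 2 → ℝ) : q ∘ ⇑(Equiv.swap (0 : Fin 2) 1) = ![q 1, q 0] := by
  funext i
  fin_cases i <;> simp

/-- The swap is an involution. [folklore] -/
theorem swap_swap_eq (q : Fin 2 → ℝ) : ![(![q 1, q 0]) 1, (![q 1, q 0]) 0] = q := by
  funext i
  fin_cases i <;> simp

/-- The swap of a `ℚ`-semialgebraic planar set is `ℚ`-semialgebraic (preimage under a coordinate
map). [cite: BochnakCosteRoy1998, §2.1] -/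
theorem isSemialgebraic_swap {s : Set (Fin 2 → ℝ)} (hs : IsSemialgebraic ℚ s) :
    IsSemialgebraic ℚ {q : Fin 2 → ℝ | ![q 1, q 0] ∈ s} := by
  convert hs.preimage_comp ⇑(Equiv.swap (0 : Fin 2) 1) using 1
  ext q
  simp only [mem_setOf_eq, mem_preimage, comp_swap_eq]

/-- The swap map is a `ℚ`-semialgebraic (indeed polynomial) map on every `ℚ`-semialgebraic
planar set. [cite: BochnakCosteRoy1998, §2.2] -/
theorem isSemialgebraicMapOn_swap {s : Set (Fin 2 → ℝ)} (hs : IsSemialgebraic ℚ s) :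
    IsSemialgebraicMapOn ℚ s (fun q : Fin 2 → ℝ => ![q 1, q 0]) := by
  refine (isSemialgebraicMapOn_aeval hs
    fun j => MvPolynomial.X (Equiv.swap (0 : Fin 2) 1 j)).congr fun q _ => ?_
  rw [← comp_swap_eq q]
  funext j
  simp

/-- The swapped integrand `q ↦ f (q 1, q 0)` is `ℚ`-semialgebraic on the swapped domain
(composite of a semialgebraic function with a semialgebraic map, Tarski–Seidenberg).
[cite: BochnakCosteRoy1998, Prop. 2.2.6] -/
theorem isSemialgebraicFunOn_swap {s : Set (Fin 2 → ℝ)} {f : (Fin 2 → ℝ) → ℝ}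
    (hs : IsSemialgebraic ℚ s) (hf : IsSemialgebraicFunOn ℚ s f) :
    IsSemialgebraicFunOn ℚ {q : Fin 2 → ℝ | ![q 1, q 0] ∈ s} (fun q => f ![q 1, q 0]) :=
  IsSemialgebraicFunOn.comp_isSemialgebraicMapOn_holds hf
    (isSemialgebraicMapOn_swap (isSemialgebraic_swap hs)) fun _ hq => hq

/-- Precomposition with the transposition `(0 1)` is a measurable embedding of the plane (it is
a measurable equivalence). [folklore] -/
theorem measurableEmbedding_comp_swap :
    MeasurableEmbedding fun q : Fin 2 → ℝ => q ∘ ⇑(Equiv.swap (0 : Fin 2) 1) := by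
  set e : (Fin 2 → ℝ) ≃ᵐ (Fin 2 → ℝ) :=
    (MeasurableEquiv.piCongrLeft (fun _ : Fin 2 => ℝ) (Equiv.swap (0 : Fin 2) 1)).symm with he
  have hcoe : ⇑e = fun q : Fin 2 → ℝ => q ∘ ⇑(Equiv.swap (0 : Fin 2) 1) := by
    funext q a
    simp [he, MeasurableEquiv.piCongrLeft, Equiv.piCongrLeft_symm_apply]
  rw [← hcoe]
  exact e.measurableEmbedding

/-- Absolute integrability is transported along the swap: if `f` is integrable on `s` then
`q ↦ f (q 1, q 0)` is integrable on `{q | (q 1, q 0) ∈ s}` (the swap preserves Lebesgue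
measure). [folklore] -/
theorem integrableOn_swap {s : Set (Fin 2 → ℝ)} {f : (Fin 2 → ℝ) → ℝ}
    (hf : IntegrableOn f s volume) :
    IntegrableOn (fun q => f ![q 1, q 0]) {q : Fin 2 → ℝ | ![q 1, q 0] ∈ s} volume := by
  have key :
      (fun q : Fin 2 → ℝ => ![q 1, q 0]) = fun q => q ∘ ⇑(Equiv.swap (0 : Fin 2) 1) :=
    funext fun q => (comp_swap_eq q).symm
  show IntegrableOn (f ∘ fun q : Fin 2 → ℝ => ![q 1, q 0])
    ((fun q : Fin 2 → ℝ => ![q 1, q 0]) ⁻¹' s) volume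
  rw [key]
  exact ((Grounding.measurePreserving_comp_perm (m := 1)
    (Equiv.swap (0 : Fin 2) 1)).integrableOn_comp_preimage measurableEmbedding_comp_swap).2 hf

/-- **Existence of the swapped representation** `r' = [swap⁻¹ σ, f ∘ swap]` of a planar
representation `r = [σ, f]`. [cite: KontsevichZagier2001, §1.2] -/
theorem exists_swapRep (r : KZ.IntegralRep 2) : ∃ r' : KZ.IntegralRep 2,
    r'.domain = {q : Fin 2 → ℝ | ![q 1, q 0] ∈ r.domain} ∧
    ∀ q, r'.integrand q = r.integrand ![q 1, q 0] :=
  ⟨{ domain := {q : Fin 2 → ℝ | ![q 1, q 0] ∈ r.domain}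
     integrand := fun q => r.integrand ![q 1, q 0]
     isSemialgebraic_domain := isSemialgebraic_swap r.isSemialgebraic_domain
     isSemialgebraicFunOn_integrand :=
       isSemialgebraicFunOn_swap r.isSemialgebraic_domain r.isSemialgebraicFunOn_integrand
     integrableOn := integrableOn_swap r.integrableOn }, rfl, fun _ => rfl⟩

/-! ## The permutation matrix and its determinant -/

/-- The swap is (the underlying map of) a continuous linear endomorphism of the plane.
[folklore] -/
theorem exists_swapCLM :
    ∃ L : (Fin 2 → ℝ) →L[ℝ] (Fin 2 → ℝ), ∀ x, L x = ![x 1, x 0] :=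
  ⟨LinearMap.toContinuousLinearMap (LinearMap.funLeft ℝ ℝ ⇑(Equiv.swap (0 : Fin 2) 1)),
    fun x => by
      rw [LinearMap.coe_toContinuousLinearMap']
      exact comp_swap_eq x⟩

/-- A linear swap is an involution, hence `det = ±1` and `|det| = 1`. [folklore] -/
theorem abs_det_eq_one_of_swap {L : (Fin 2 → ℝ) →L[ℝ] (Fin 2 → ℝ)}
    (hL : ∀ x, L x = ![x 1, x 0]) : |L.det| = 1 := by
  have hLL : ∀ x, L (L x) = x := fun x => by
    rw [hL (L x), hL x]
    exact swap_swap_eq x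
  have hcomp : (L : (Fin 2 → ℝ) →ₗ[ℝ] (Fin 2 → ℝ)).comp
      (L : (Fin 2 → ℝ) →ₗ[ℝ] (Fin 2 → ℝ)) = LinearMap.id :=
    LinearMap.ext fun x => hLL x
  have h1 : L.det * L.det = 1 := by
    have h := LinearMap.det_comp (L : (Fin 2 → ℝ) →ₗ[ℝ] (Fin 2 → ℝ))
      (L : (Fin 2 → ℝ) →ₗ[ℝ] (Fin 2 → ℝ))
    rw [hcomp, LinearMap.det_id] at h
    exact h.symm
  rcases mul_self_eq_one_iff.mp h1 with h | h
  · rw [h, abs_one]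
  · rw [h, abs_neg, abs_one]

/-! ## The stub -/

/-- **The coordinate swap is a move** (rule 2 with the permutation matrix, `|det| = 1`), for an
arbitrary planar representation: `[σ, f] ≡ [swap⁻¹ σ, f ∘ swap]`.
[cite: KontsevichZagier2001, §1.2 rule (2)] -/
theorem stub_swap : ∀ r : KZ.IntegralRep 2, ∃ r' : KZ.IntegralRep 2,
    r'.domain = {q : Fin 2 → ℝ | ![q 1, q 0] ∈ r.domain} ∧
    (∀ q ∈ r'.domain, r'.integrand q = r.integrand ![q 1, q 0]) ∧
    KZ.of r - KZ.of r' ∈ KZ.relations := by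
  intro r
  obtain ⟨r', hd, hi⟩ := exists_swapRep r
  obtain ⟨L, hL⟩ := exists_swapCLM
  refine ⟨r', hd, fun q _ => hi q, ?_⟩
  have hLL : ∀ x, L (L x) = x := fun x => by
    rw [hL (L x), hL x]
    exact swap_swap_eq x
  -- `Φ = L` is a `ℚ`-semialgebraic (polynomial) map on the domain
  have hLsa : IsSemialgebraicMapOn ℚ r.domain ⇑L :=
    (isSemialgebraicMapOn_swap r.isSemialgebraic_domain).congr fun x _ => (hL x).symm
  -- `Φ` is injective
  have hLinj : InjOn ⇑L r.domain := fun x _ y _ hxy => by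
    have h := congr_arg L hxy
    rwa [hLL x, hLL y] at h
  -- `r'.domain = Φ '' r.domain`
  have himage : r'.domain = ⇑L '' r.domain := by
    rw [hd]
    ext y
    constructor
    · intro hy
      exact ⟨L y, by rw [hL y]; exact hy, hLL y⟩
    · rintro ⟨x, hx, rfl⟩
      show ![(L x) 1, (L x) 0] ∈ r.domain
      rw [hL x, swap_swap_eq x]
      exact hx
  -- the Jacobian identity `f x = f' (Φ x) * |det Φ'|`
  have hdet : |L.det| = 1 := abs_det_eq_one_of_swap hL
  refine KZ.changeOfVariablesRel_subset_relations ⟨2, r, r', L, fun _ => L, hLsa,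
    fun _ _ => L.hasFDerivWithinAt, hLinj, himage, fun x _ => ?_, rfl⟩
  rw [hdet, mul_one, hi (L x), hL x, swap_swap_eq x]

end Summit.KontsevichZagierPeriods.SymplecticScissors.PlanarAreas

end
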